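import Summits.AtomisticToContinuum.BoseEinsteinCondensation.Theorems.BECGroundStateSOSPeriodicIRBoundTwoSectorFloatingDefs
import Summits.AtomisticToContinuum.BoseEinsteinCondensation.Theorems.BECGroundStateSOSPeriodicIRBoundTwoSectorKLS
import Summits.AtomisticToContinuum.BoseEinsteinCondensation.Theorems.BECGroundStateSOSPeriodicIRBoundTwoSectorWindow
import HarnessLib

/-!
# Route `BECGroundStateSOS`, crux `PeriodicIRBound` (stmt-AtomisticToContinuum-3972), line `two-sector-gd-transfer`
# (v7 "floating thresholds") — stub S8 `stub_pooledToFloating : PooledToFloating`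

Supports (does not close) stmt-AtomisticToContinuum-3972. The registered stub S8 of the v7 skeleton
`Cruxes/PeriodicIRBound/Lines/two_sector_gd_transfer.lean` (statement `PooledToFloating` in
`Theorems/BECGroundStateSOSPeriodicIRBoundTwoSectorFloatingDefs.lean`): for ONE integrable admissible potential `v`, the
two-channel susceptibility bound `TwoChannelSusceptibility v K ρ₀ C` (the v6 input obtained from Gaussian domination by the
Kato step) together with midpoint near-convexity `ConvexityFor v` of `N ↦ E₀^per(N, L)` give the floating two-channel
bound `FloatingFor v K ρ₀' C` with `ρ₀' := min (ρ₀/2) ρ₁` (`ρ₁` the density threshold of convexity).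

Proof. Two fixed-`(N, L)` lemmas isolate the channel blocks `hchanP`, `hchanM` of the landed S4 proof `KLS.klsMomentFor`
(p138298): `chanPlus_of_suscPlus` — the regularised particle susceptibility `SuscPlus v (m+2) L n b` tested at the
normalised particle state `a†(φ_n)ψ/‖a†(φ_n)ψ‖` of a near-minimiser `ψ` of `H_{m+2}` (`‖a†ψ‖² = n_k + 1`, transfer matrix
element `Re⟨ψ, a a†ψ⟩/‖a†ψ‖ = ‖a†ψ‖` by adjointness) is the channel inequality `ChanPlus v m L n (E₀(m+3)) b`; and
`chanMinus_of_suscMinus` — `SuscMinus v (m+1) L n b` tested at `a(φ_n)ψ/‖a(φ_n)ψ‖` (`‖aψ‖² = n_k`) is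
`ChanMinus v m L n (E₀(m+1)) b` (the slack is capped at `1` so that near-minimisers have finite energy). Along
`L = L_N(ρ)`, `N = m + 2`, `ρ < min (ρ₀/2) ρ₁`: `ρ₀L³ ≥ 2N ≥ N + 1`, so the two-channel bound applies at `N` and `N − 1`
(eventually in `m`), `E₀(M, L) < ⊤` for integrable `v` (`ZeroMomentumGround.periodicGroundStateEnergy_ne_top_of_lintegral_ne_top`),
and convexity at `(N, L_N)` (density `N/L³ = ρ`, eventually in `m` via `m ↦ m + 2 → ∞`) reads in reals
`2e0 ≤ e3 + e1 + ε√(ρa)/L`; with monotonicity `e0 ≤ e3` (`WF.periodicGroundStateEnergy_le_succ`) the choice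
`μ₊ := e3 − e0 ≥ 0`, `μ₋ := e0 − e1 ≤ μ₊ + ε√(ρa)/L` turns the two lemmas into `FloatingFor`. Elementary given the landed
`WF` toolkit; nothing is cited as a fact. References for the shape only: T. Kennedy, E. H. Lieb, B. S. Shastry,
J. Stat. Phys. 53 (1988) 1019, (12)–(14).
-/

noncomputable section

open scoped BigOperators ENNReal ComplexConjugate
open Filter MeasureTheory

namespace Summit.AtomisticToContinuum.BoseEinsteinCondensation.Cruxes.PeriodicIRBound.TwoSectorGdTransfer

open Literature.MathematicalPhysics.QuantumManyBody.BoseGas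
open Summit.AtomisticToContinuum.BoseEinsteinCondensation.Cruxes.PeriodicIRBound.LinearPhFloorWagner.WF
open Summit.AtomisticToContinuum.BoseEinsteinCondensation.Cruxes.PeriodicIRBound.LinearPhFloorWagner
  (WF.periodicGroundStateEnergy_le_succ)
open Summit.AtomisticToContinuum.BoseEinsteinCondensation.Theorems.ZeroMomentumGround
  (periodicGroundStateEnergy_ne_top_of_lintegral_ne_top)

namespace PooledFloat

variable {m : ℕ} {L : ℝ}

/-- `(k + 1 : ℝ≥0∞) ≠ ⊤`. [folklore] -/
theorem natCast_add_one_ne_top (k : ℕ) : ((k : ℝ≥0∞) + 1) ≠ ⊤ :=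
  ENNReal.add_ne_top.2 ⟨ENNReal.natCast_ne_top k, ENNReal.one_ne_top⟩

/-- **Particle channel at fixed `(N, L) = (m+2, L)`**: the regularised susceptibility `SuscPlus v (m+2) L n b`, tested at
the normalised particle state `a†(φ_n)ψ/‖a†(φ_n)ψ‖` of a near-minimiser `ψ` (block `hchanP` of `KLS.klsMomentFor`), is the
channel inequality `ChanPlus` against the pinned threshold `E₀(m+3)`. [folklore] -/
theorem chanPlus_of_suscPlus (v : ℝ → ℝ≥0∞) (hw : Measurable v) (hint : (∫⁻ x : Space, v ‖x‖) ≠ ⊤)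
    (hL : 0 < L) (hE2 : periodicGroundStateEnergy v (m + 2) L ≠ ⊤) {n : Fin 3 → ℤ} {b : ℝ}
    (hP : SuscPlus v (m + 2) L n b) :
    ChanPlus v m L n (periodicGroundStateEnergy v (m + 3) L).toReal b := by
  intro η hη
  obtain ⟨δP, hδP, HP⟩ := hP η hη
  refine ⟨min δP 1, lt_min hδP one_pos, fun Ψ hΨ => ?_⟩
  set E₀ : ℝ≥0∞ := periodicGroundStateEnergy v (m + 2) L with hE₀
  set e3 : ℝ := (periodicGroundStateEnergy v (m + 3) L).toReal with he3
  -- the state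
  set ψ : Config (m + 2) → ℂ := Ψ.ψ with hψdef
  have hψc : IsCore L ψ := isCore_trialState Ψ
  have hψ1 : normSq L ψ = 1 := Ψ.norm_eq
  have hδtop : min δP 1 ≠ ⊤ := ne_top_of_le_ne_top ENNReal.one_ne_top (min_le_right _ _)
  have hψE : qform v L ψ ≤ E₀ + min δP 1 := hΨ
  have hψEtop : qform v L ψ ≠ ⊤ := ne_top_of_le_ne_top (ENNReal.add_ne_top.2 ⟨hE2, hδtop⟩) hψE
  -- the particle state `a†ψ` and its mass `‖a†ψ‖² = 1 + n_k`
  set cΨ : Config (m + 2 + 1) → ℂ := modeCr (planeWaveMode L n) ψ with hcΨ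
  have hcΨc : IsCore L cΨ := isCore_modeCr hL n hψc
  set νE : ℝ≥0∞ := cellOccupation (m + 2) L (planeWaveMode L n) ψ with hνE
  have hnCE : normSq L cΨ = 1 + νE := by rw [hcΨ, normSq_modeCr hL n hψc, hψ1]
  have hνle : νE ≤ ((m + 2 : ℕ) : ℝ≥0∞) * normSq L ψ :=
    cellOccupation_le_mul_normSq hL n hψc.contDiff.continuous
  rw [hψ1, mul_one] at hνle
  have hνtop : νE ≠ ⊤ := ne_top_of_le_ne_top (ENNReal.natCast_ne_top _) hνle
  set nA : ℝ := νE.toReal with hnA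
  have hnA0 : 0 ≤ nA := ENNReal.toReal_nonneg
  have hnCtop : normSq L cΨ ≠ ⊤ := by
    rw [hnCE]; exact ENNReal.add_ne_top.2 ⟨ENNReal.one_ne_top, hνtop⟩
  have hnC0 : normSq L cΨ ≠ 0 := by
    rw [hnCE]; exact ne_of_gt (lt_of_lt_of_le zero_lt_one le_self_add)
  have hnCr : (normSq L cΨ).toReal = nA + 1 := by
    rw [hnCE, ENNReal.toReal_add ENNReal.one_ne_top hνtop, ENNReal.toReal_one]; ring
  have hnA1 : 0 < nA + 1 := by linarith
  -- a priori finiteness of `𝓔[a†ψ]`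
  have hcΨE := qform_modeCr_le hL hw hint n hψc
  have hcΨEtop : qform v L cΨ ≠ ⊤ :=
    ne_top_of_le_ne_top (ENNReal.mul_ne_top (natCast_add_one_ne_top _) (ENNReal.add_ne_top.2
      ⟨hψEtop, ENNReal.mul_ne_top ENNReal.ofReal_ne_top (by rw [hψ1]; exact ENNReal.one_ne_top)⟩)) hcΨE
  set qC : ℝ := (qform v L cΨ).toReal with hqC
  -- ===== the normalised particle state `a†ψ/‖a†ψ‖` =====
  have hchanP : (nA + 1) ^ 2 ≤ b * ((1 + η) * (qC - e3 * (nA + 1)) + η * (nA + 1)) := by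
    set Φp : PeriodicTrialState (m + 2 + 1) L := hcΨc.toTrialState hnC0 hnCtop with hΦp
    have hΦpE : periodicEnergy v Φp = (normSq L cΨ)⁻¹ * qform v L cΨ :=
      hcΨc.periodicEnergy_toTrialState v hnC0 hnCtop
    have hΦpEtop : periodicEnergy v Φp ≠ ⊤ := by
      rw [hΦpE]; exact ENNReal.mul_ne_top (ENNReal.inv_ne_top.2 hnC0) hcΨEtop
    have hΦpEr : (periodicEnergy v Φp).toReal = qC / (nA + 1) := by
      rw [hΦpE, ENNReal.toReal_mul, ENNReal.toReal_inv, hnCr, inv_mul_eq_div]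
    have hΨnear : NearMinAt v δP Ψ := le_trans hΨ (add_le_add le_rfl (min_le_left _ _))
    have hPΨ := HP Ψ hΨnear Φp hΦpEtop
    -- the transfer matrix element is `‖a†ψ‖ = √(nA + 1)`
    have hMp : Real.sqrt (((m + 2 : ℕ) : ℝ) + 1) * transferIntegralRe L n Ψ.ψ Φp.ψ = Real.sqrt (nA + 1) := by
      rw [sqrt_mul_transferIntegralRe]
      have hΦpψ : Φp.ψ = fun X => ((Real.sqrt (normSq L cΨ).toReal)⁻¹ : ℂ) * cΨ X :=
        hcΨc.toTrialState_ψ hnC0 hnCtop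
      rw [hΦpψ, hnCr, KLS.modeAn_const_mul]
      have hfun : (fun Y => conj (Ψ.ψ Y) * (((Real.sqrt (nA + 1))⁻¹ : ℂ) * modeAn L (planeWaveMode L n) cΨ Y)) =
          fun Y => ((Real.sqrt (nA + 1))⁻¹ : ℂ) * (conj (ψ Y) * modeAn L (planeWaveMode L n) cΨ Y) := by
        funext Y; rw [hψdef]; ring
      rw [hfun, integral_const_mul]
      have hadj : ∫ Y in cellN (m + 2) L, conj (ψ Y) * modeAn L (planeWaveMode L n) cΨ Y =
          ((nA + 1 : ℝ) : ℂ) := by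
        rw [← integral_conj_modeCr_mul (continuous_planeWaveMode L n).measurable (norm_planeWaveMode_le L n)
          hψc.contDiff.continuous hcΨc.contDiff.continuous hcΨc.symm]
        rw [integral_conj_mul_self_eq L hcΨc.contDiff.continuous, hnCr]
      rw [hadj]
      exact KLS.re_inv_sqrt_mul_self hnA1.le
    rw [hMp, Real.sq_sqrt hnA1.le, hΦpEr] at hPΨ
    -- multiply by `nA + 1 > 0`
    have h := mul_le_mul_of_nonneg_left hPΨ hnA1.le
    have heq : (nA + 1) * (b * ((1 + η) * (qC / (nA + 1) - e3) + η)) =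
        b * ((1 + η) * (qC - e3 * (nA + 1)) + η * (nA + 1)) := by
      field_simp
    calc (nA + 1) ^ 2 = (nA + 1) * (nA + 1) := by ring
      _ ≤ (nA + 1) * (b * ((1 + η) * (qC / (nA + 1) - e3) + η)) := h
      _ = _ := heq
  intro nk qC'
  exact hchanP

/-- **Hole channel at fixed `(N, L) = (m+2, L)`**: the regularised susceptibility `SuscMinus v (m+1) L n b` (pair
`(m+1, m+2)`), tested at the normalised excitation `a(φ_n)ψ/‖a(φ_n)ψ‖` of a near-minimiser `ψ` of `H_{m+2}` (block
`hchanM` of `KLS.klsMomentFor`; the case `n_k = 0` is trivial for `b ≥ 0`), is the channel inequality `ChanMinus`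
against the pinned threshold `E₀(m+1)`. [folklore] -/
theorem chanMinus_of_suscMinus (v : ℝ → ℝ≥0∞) (hw : Measurable v) (hL : 0 < L)
    (hE2 : periodicGroundStateEnergy v (m + 2) L ≠ ⊤) {n : Fin 3 → ℤ} {b : ℝ} (hb : 0 ≤ b)
    (hM : SuscMinus v (m + 1) L n b) :
    ChanMinus v m L n (periodicGroundStateEnergy v (m + 1) L).toReal b := by
  intro η hη
  obtain ⟨δM, hδM, HM⟩ := hM η hη
  refine ⟨min δM 1, lt_min hδM one_pos, fun Ψ hΨ => ?_⟩
  set E₀ : ℝ≥0∞ := periodicGroundStateEnergy v (m + 2) L with hE₀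
  set e1 : ℝ := (periodicGroundStateEnergy v (m + 1) L).toReal with he1
  -- the state
  set ψ : Config (m + 2) → ℂ := Ψ.ψ with hψdef
  have hψc : IsCore L ψ := isCore_trialState Ψ
  have hψ1 : normSq L ψ = 1 := Ψ.norm_eq
  have hδtop : min δM 1 ≠ ⊤ := ne_top_of_le_ne_top ENNReal.one_ne_top (min_le_right _ _)
  have hψE : qform v L ψ ≤ E₀ + min δM 1 := hΨ
  have hψEtop : qform v L ψ ≠ ⊤ := ne_top_of_le_ne_top (ENNReal.add_ne_top.2 ⟨hE2, hδtop⟩) hψE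
  -- the excitation `aψ` and its mass `‖aψ‖² = n_k`
  set aΨ : Config (m + 1) → ℂ := modeAn L (planeWaveMode L n) ψ with haΨ
  have haΨc : IsCore L aΨ := isCore_modeAn hL n hψc
  set νE : ℝ≥0∞ := cellOccupation (m + 2) L (planeWaveMode L n) ψ with hνE
  have hnAE : normSq L aΨ = νE := normSq_modeAn hL n ψ
  have hνle : νE ≤ ((m + 2 : ℕ) : ℝ≥0∞) * normSq L ψ :=
    cellOccupation_le_mul_normSq hL n hψc.contDiff.continuous
  rw [hψ1, mul_one] at hνle
  have hνtop : νE ≠ ⊤ := ne_top_of_le_ne_top (ENNReal.natCast_ne_top _) hνle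
  set nA : ℝ := νE.toReal with hnA
  have hnA0 : 0 ≤ nA := ENNReal.toReal_nonneg
  have hnAtop : normSq L aΨ ≠ ⊤ := by rw [hnAE]; exact hνtop
  have hnAr : (normSq L aΨ).toReal = nA := by rw [hnAE]
  -- a priori finiteness of `𝓔[aψ]`
  have haΨE := qform_modeAn_le hL hw n hψc
  have haΨEtop : qform v L aΨ ≠ ⊤ :=
    ne_top_of_le_ne_top (ENNReal.mul_ne_top (natCast_add_one_ne_top _) hψEtop) haΨE
  set qA : ℝ := (qform v L aΨ).toReal with hqA
  -- ===== the normalised excitation `aψ/‖aψ‖` =====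
  have hchanM : nA ^ 2 ≤ b * ((1 + η) * (qA - e1 * nA) + η * nA) := by
    rcases eq_or_ne νE 0 with hν0 | hν0
    · have hnA00 : nA = 0 := by rw [hnA, hν0, ENNReal.toReal_zero]
      rw [hnA00]
      have : 0 ≤ b * ((1 + η) * qA) := by positivity
      nlinarith
    have hnA0' : normSq L aΨ ≠ 0 := by rwa [hnAE]
    set Φm : PeriodicTrialState (m + 1) L := haΨc.toTrialState hnA0' hnAtop with hΦm
    have hΦmE : periodicEnergy v Φm = (normSq L aΨ)⁻¹ * qform v L aΨ :=
      haΨc.periodicEnergy_toTrialState v hnA0' hnAtop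
    have hΦmEtop : periodicEnergy v Φm ≠ ⊤ := by
      rw [hΦmE]; exact ENNReal.mul_ne_top (ENNReal.inv_ne_top.2 hnA0') haΨEtop
    have hΦmEr : (periodicEnergy v Φm).toReal = qA / nA := by
      rw [hΦmE, ENNReal.toReal_mul, ENNReal.toReal_inv, hnAr, inv_mul_eq_div]
    have hΨnear : NearMinAt v δM Ψ := le_trans hΨ (add_le_add le_rfl (min_le_left _ _))
    have hMΨ := HM Ψ hΨnear Φm hΦmEtop
    -- the transfer matrix element is `‖aψ‖ = √nA`
    have hMm : Real.sqrt (((m + 1 : ℕ) : ℝ) + 1) * transferIntegralRe L n Φm.ψ Ψ.ψ = Real.sqrt nA := by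
      rw [sqrt_mul_transferIntegralRe]
      have hΦmψ : Φm.ψ = fun X => ((Real.sqrt (normSq L aΨ).toReal)⁻¹ : ℂ) * aΨ X :=
        haΨc.toTrialState_ψ hnA0' hnAtop
      rw [hΦmψ, hnAr]
      have hfun : (fun Y => conj (((Real.sqrt nA)⁻¹ : ℂ) * aΨ Y) * modeAn L (planeWaveMode L n) Ψ.ψ Y) =
          fun Y => ((Real.sqrt nA)⁻¹ : ℂ) * (conj (aΨ Y) * aΨ Y) := by
        funext Y
        rw [map_mul, ← Complex.ofReal_inv, Complex.conj_ofReal, haΨ, hψdef]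
        ring
      rw [hfun, integral_const_mul, integral_conj_mul_self_eq L haΨc.contDiff.continuous, hnAr]
      exact KLS.re_inv_sqrt_mul_self hnA0
    rw [hMm, Real.sq_sqrt hnA0, hΦmEr] at hMΨ
    have h := mul_le_mul_of_nonneg_left hMΨ hnA0
    have hnAne : nA ≠ 0 := (ENNReal.toReal_pos hν0 hνtop).ne'
    have heq : nA * (b * ((1 + η) * (qA / nA - e1) + η)) = b * ((1 + η) * (qA - e1 * nA) + η * nA) := by
      field_simp
    calc nA ^ 2 = nA * nA := by ring
      _ ≤ nA * (b * ((1 + η) * (qA / nA - e1) + η)) := h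
      _ = _ := heq
  intro nk qA'
  exact hchanM

end PooledFloat

/-! ### The stub -/

/-- **Stub S8 — the bridge from the v6 inputs.** For an integrable admissible `v`, the two-channel susceptibility bound
with data `(K, ρ₀, C)` and midpoint near-convexity of `N ↦ E₀^per(N, L)` give the floating two-channel bound
`FloatingFor v K (min (ρ₀/2) ρ₁) C`: along `L = L_N(ρ)`, `N = m + 2`, the pinned channel inequalities
(`PooledFloat.chanPlus_of_suscPlus` at `N`, `PooledFloat.chanMinus_of_suscMinus` at the pair `(N−1, N)`) hold against
`E₀(N+1) = E₀(N) + μ₊` and `E₀(N−1) = E₀(N) − μ₋` with `μ₊ := E₀(N+1) − E₀(N) ≥ 0` (monotonicity) and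
`μ₋ := E₀(N) − E₀(N−1) ≤ μ₊ + ε√(ρa)/L` (convexity at `(N, L_N)`). [folklore] -/
theorem stub_pooledToFloating : PooledToFloating := by
  intro v hv hint K ρ₀ C _hK hρ₀ hC hTC hconv
  obtain ⟨ρ₁, hρ₁, Hconv⟩ := hconv
  obtain ⟨N₀, hN₀⟩ := eventually_atTop.1 hTC
  set a : ℝ := (scatteringLength v).toReal with hadef
  refine ⟨min (ρ₀ / 2) ρ₁, by positivity, ?_⟩
  intro ε hε ρ hρ hρlt
  have hρ1 : ρ < ρ₀ / 2 := hρlt.trans_le (min_le_left _ _)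
  have hρ2 : ρ < ρ₁ := hρlt.trans_le (min_le_right _ _)
  filter_upwards [eventually_ge_atTop N₀, (tendsto_add_atTop_nat 2).eventually (Hconv ε hε ρ hρ hρ2)]
    with m hm hconvm
  intro n hn hnK
  -- notation and side conditions along `L = L_N(ρ)`, `L³ = N/ρ`
  have hL : 0 < sideLength ρ (m + 2) := sideLength_pos_of_pos hρ (by omega)
  have hL3 : sideLength ρ (m + 2) ^ 3 = ((m + 2 : ℕ) : ℝ) / ρ := sideLength_pow_three hρ (m + 2)
  set L := sideLength ρ (m + 2) with hLdef
  have hfin : ∀ M : ℕ, periodicGroundStateEnergy v M L ≠ ⊤ := fun M =>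
    periodicGroundStateEnergy_ne_top_of_lintegral_ne_top hv.1 hint M hL
  have hbig : (m : ℝ) + 3 ≤ ρ₀ * L ^ 3 := by
    rw [hL3, mul_div_assoc', le_div_iff₀ hρ]
    push_cast
    nlinarith [mul_le_mul_of_nonneg_left hρ1.le (by positivity : (0 : ℝ) ≤ (m : ℝ) + 3),
      mul_nonneg hρ₀.le (m.cast_nonneg (α := ℝ))]
  have hsideN : ((m + 2 : ℕ) : ℝ) + 1 ≤ ρ₀ * L ^ 3 := by push_cast; linarith
  have hsideN' : ((m + 1 : ℕ) : ℝ) + 1 ≤ ρ₀ * L ^ 3 := by push_cast; linarith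
  have hne : ((m + 2 : ℕ) : ℝ) ≠ 0 := by positivity
  have hdens : ((m + 2 : ℕ) : ℝ) / L ^ 3 = ρ := by
    rw [hL3, div_div_eq_mul_div, mul_div_cancel_left₀ _ hne]
  -- the two-channel bound at `N = m + 2` and at `N - 1 = m + 1`, monotonicity, convexity at `N`
  have hTCN := hN₀ (m + 2) (by omega) L hL hsideN (hfin _) (hfin _)
  have hTCN' := hN₀ (m + 1) (by omega) L hL hsideN' (hfin _) (hfin _)
  have he0 : 0 ≤ ε * Real.sqrt (ρ * a) / L := by positivity
  have hmono : (periodicGroundStateEnergy v (m + 2) L).toReal ≤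
      (periodicGroundStateEnergy v (m + 3) L).toReal :=
    ENNReal.toReal_mono (hfin _) (WF.periodicGroundStateEnergy_le_succ hL hv.1 (m + 2))
  have hconvR : 2 * (periodicGroundStateEnergy v (m + 2) L).toReal ≤
      (periodicGroundStateEnergy v (m + 3) L).toReal + (periodicGroundStateEnergy v (m + 1) L).toReal +
        ε * Real.sqrt (ρ * a) / L := by
    have h := ENNReal.toReal_mono (ENNReal.add_ne_top.2 ⟨ENNReal.add_ne_top.2 ⟨hfin _, hfin _⟩,
      ENNReal.ofReal_ne_top⟩) (hconvm L hL (by rw [hdens]; linarith) (by rw [hdens]; linarith))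
    rw [ENNReal.toReal_add (ENNReal.add_ne_top.2 ⟨hfin _, hfin _⟩) ENNReal.ofReal_ne_top,
      ENNReal.toReal_add (hfin _) (hfin _), ENNReal.toReal_ofReal he0, ENNReal.toReal_mul,
      ENNReal.toReal_ofNat] at h
    exact h
  obtain ⟨hSP, -⟩ := hTCN n hn hnK
  obtain ⟨-, hSM⟩ := hTCN' n hn hnK
  have hb : 0 ≤ C * L ^ 2 / ‖(fun j => (n j : ℝ))‖ ^ 2 := by positivity
  set e0 : ℝ := (periodicGroundStateEnergy v (m + 2) L).toReal with he0def
  set e1 : ℝ := (periodicGroundStateEnergy v (m + 1) L).toReal with he1def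
  set e3 : ℝ := (periodicGroundStateEnergy v (m + 3) L).toReal with he3def
  refine ⟨e3 - e0, e0 - e1, by linarith, by linarith, ?_, ?_⟩
  · have h3 : e0 + (e3 - e0) = e3 := by ring
    rw [h3]
    exact PooledFloat.chanPlus_of_suscPlus v hv.1 hint hL (hfin _) hSP
  · have h1 : e0 - (e0 - e1) = e1 := by ring
    rw [h1]
    exact PooledFloat.chanMinus_of_suscMinus v hv.1 hL (hfin _) hb hSM

end Summit.AtomisticToContinuum.BoseEinsteinCondensation.Cruxes.PeriodicIRBound.TwoSectorGdTransfer

end
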